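import Literature.Computability.Complexity.CountingProofs
import Literature.Computability.Complexity.SharpPClosure
import HarnessLib

/-!
# `PP` via `GapP` (Fenner–Fortnow–Kurtz, Proposition 4.2(1)) — proof

Second sibling proof file of `Counting.lean` (D-0014; `CountingProofs.lean` is at the line cap and
does not import the witness-padding lemmas of `SharpPClosure.lean`). Discharged here:

* `mem_PP_iff_gapP_holds : mem_PP_iff_gapP` — **`L ∈ PP ↔ ∃ g ∈ GapP, ∀ x, (x ∈ L ↔ 0 < g x)`**
  (Fenner–Fortnow–Kurtz 1994, Proposition 4.2(1), p. 127: "`L ∈ PP ⟺ (∃M)(∀x)[x ∈ L ⟺ gap_M(x) > 0]`",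
  with `GapP = {gap_M} = #P − #P`, Def. 3.2 and Proposition 3.5, p. 121).

Printed proof (p. 128) and its rendering in the tree's conventions (`PP = pMajority P`: strict
majority of the `2^{p(|x|)}` coin strings, Gill's threshold; `GapP := #P − #P`, `Counting.lean`):

* (→) "from Lemma 3.3 (`#P ⊆ GapP`) and subtracting a polynomial-time computable threshold from a
  gap": for `L ∈ PP` with witness language `L' ∈ P` and `m = p(|x|)` coins, the machine running
  `L'` on every coin string is in normal form, and its gap
  `g(x) = #{y | ⟨x,y⟩ ∈ L'} − #{y | ⟨x,y⟩ ∉ L'}` (both terms in `#P`, the second by `L'ᶜ ∈ P`) is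
  positive iff the accepting strings are a strict majority (`#acc + #rej = 2^m`,
  `half_lt_uniformProb_iff`) — `PPGapP.gapP_of_mem_PP`.
* (←) "by Lemma 4.3, threshold `2^{q(|x|)} − 1`", i.e. the machine `M'` of the proof of
  Proposition 3.5 (p. 122: "`M'` first branches once, then simulates `M` on one branch and `N̄` on
  the other", `#M'(x) = f(x) − g(x) + 2^{q(|x|)}`) read as a majority vote: for `g = f₁ − f₂` with
  `f₁, f₂ ∈ #P`, pad both witness relations to the common length `B = (p₁ + p₂)(|x|)`
  (`exists_padRel`, `countWitnesses_of_padSpec`, `SharpPClosure.lean`) and take `B + 1` coins `b·y`: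
  `b = 0` accepts iff `⟨x,y⟩ ∈ R₁`, `b = 1` accepts iff `⟨x,y⟩ ∉ R₂` (`PPGapP.exists_sumRel`, the
  relation `(Tag₀ ⊓ drop₁⁻¹ R₁) ⊔ (Tag₁ ⊓ drop₁⁻¹ R₂ᶜ)` exactly as in `PPSharpP.exists_msbRel`), so
  `#acc = f₁(x) + 2^B − f₂(x)`, a strict majority of `2^{B+1}` iff `f₁(x) > f₂(x)` —
  `PPGapP.mem_PP_of_gapP`.

No definitions are introduced (the relations are existence statements, as in `CountingProofs.lean`).

## References

* S. Fenner, L. Fortnow, S. Kurtz, *Gap-definable counting classes*, J. Comput. System Sci. 48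
  (1994) 116–148: Def. 3.1–3.2 (`gap_M`, `GapP`), Lemma 3.3 (`#P ⊆ GapP`), Proposition 3.5
  (`GapP = #P − #P`, the machine `M'`), Proposition 4.2(1) and its proof (p. 127–128), Lemma 4.3.
* J. Gill, *Computational complexity of probabilistic Turing machines*, SIAM J. Comput. 6 (1977),
  Def. 5.1 (`PP`).
* S. Arora, B. Barak, *Computational Complexity: A Modern Approach*, CUP 2009, §17.2.1, proof of
  Lemma 17.7 (the machines `M₀ + M₁`).
-/

noncomputable section

namespace Literature.Computability.Complexity

open _root_.Computability Polynomial TTClosure PPSharpP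

namespace PPGapP

/-! ### Counting lemmas -/

/-- `#{y ∈ {0,1}^m | ⟨x,y⟩ ∈ L'} + #{y ∈ {0,1}^m | ⟨x,y⟩ ∈ L'ᶜ} = 2^m` (accepting plus rejecting
coin strings; the gap of a normal-form machine is `#acc − #rej`). [cite: FennerFortnowKurtz1994, Def. 3.1] -/
theorem countWitnesses_add_compl (L' : Language Bool) (m : ℕ) (x : List Bool) :
    countWitnesses L' m x + countWitnesses L'ᶜ m x = 2 ^ m := by
  rw [countWitnesses_eq_cnt, countWitnesses_eq_cnt]
  have hc : cnt m {y | boolPair x y ∈ L'ᶜ} = cnt m ({y | boolPair x y ∈ L'}ᶜ) :=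
    cnt_congr fun y _ => Iff.rfl
  rw [hc]
  exact cnt_add_cnt_compl m {y | boolPair x y ∈ L'}

/-! ### The sum relation (branch once, then run one of two machines) -/

/-- **The sum relation.** For `L₀, L₁ ∈ P` there is `R ∈ P` reading the first witness bit as a
branch: `⟨x, 0y⟩ ∈ R ↔ ⟨x, y⟩ ∈ L₀` and `⟨x, 1y⟩ ∈ R ↔ ⟨x, y⟩ ∈ L₁` — Fenner–Fortnow–Kurtz's machine
"branch once, then simulate `M` on one branch and `N̄` on the other" (proof of Proposition 3.5),
Arora–Barak's `M₀ + M₁` (proof of Lemma 17.7). Here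
`R = (Tag₀ ⊓ drop₁⁻¹ L₀) ⊔ (Tag₁ ⊓ drop₁⁻¹ L₁)` with `Tag_b = {⟨x, b y⟩}` (read off
`truncSndFn 1 ⟨x, b y⟩ = ⟨x, b⟩`) and `drop₁ = dropSndFn 1 : ⟨x, b y⟩ ↦ ⟨x, y⟩`
(`CoinTruncation.lean`), in `P` by closure under `FP` preimages, `⊓`, `⊔`; cf. `PPSharpP.exists_msbRel`.
[cite: FennerFortnowKurtz1994, Proposition 3.5 (proof)] -/
theorem exists_sumRel {L₀ L₁ : Language Bool} (h₀ : L₀ ∈ Classes.P) (h₁ : L₁ ∈ Classes.P) :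
    ∃ R ∈ Classes.P, (∀ x y : List Bool, boolPair x (false :: y) ∈ R ↔ boolPair x y ∈ L₀) ∧
      (∀ x y : List Bool, boolPair x (true :: y) ∈ R ↔ boolPair x y ∈ L₁) := by
  set Tag1 : Language Bool := (sndP ∘ truncSndFn 1) ⁻¹' HasBit true with hTag1
  set Tag0 : Language Bool := (sndP ∘ truncSndFn 1) ⁻¹' NoBit true with hTag0
  set R : Language Bool := (Tag0 ⊓ (dropSndFn 1 ⁻¹' L₀)) ⊔ (Tag1 ⊓ (dropSndFn 1 ⁻¹' L₁)) with hR
  have hTag1P : Tag1 ∈ Classes.P :=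
    preimage_mem_P (HasBit_mem_P true) (comp_mem_FP sndP_mem_FP (truncSndFn_mem_FP 1))
  have hTag0P : Tag0 ∈ Classes.P :=
    preimage_mem_P (NoBit_mem_P true) (comp_mem_FP sndP_mem_FP (truncSndFn_mem_FP 1))
  have hRP : R ∈ Classes.P :=
    union_mem_P (inter_mem_P hTag0P (preimage_mem_P h₀ (dropSndFn_mem_FP 1)))
      (inter_mem_P hTag1P (preimage_mem_P h₁ (dropSndFn_mem_FP 1)))
  have htrunc : ∀ (x : List Bool) (b : Bool) (y : List Bool),
      truncSndFn 1 (boolPair x (b :: y)) = boolPair x [b] := fun x b y => by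
    rw [truncSndFn_boolPair, eval_one]; rfl
  have hdrop : ∀ (x : List Bool) (b : Bool) (y : List Bool),
      dropSndFn 1 (boolPair x (b :: y)) = boolPair x y := fun x b y => by
    rw [dropSndFn_boolPair, eval_one]; rfl
  have hT1 : ∀ (x : List Bool) (b : Bool) (y : List Bool),
      boolPair x (b :: y) ∈ Tag1 ↔ b = true := by
    intro x b y
    rw [hTag1, memL_preimage, Function.comp_apply, htrunc, sndP_boolPair, mem_HasBit]
    simp
  have hT0 : ∀ (x : List Bool) (b : Bool) (y : List Bool),
      boolPair x (b :: y) ∈ Tag0 ↔ b = false := by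
    intro x b y
    rw [hTag0, memL_preimage, Function.comp_apply, htrunc, sndP_boolPair, mem_NoBit]
    simp
  refine ⟨R, hRP, fun x y => ?_, fun x y => ?_⟩
  · rw [hR, memL_sup, Language.mem_inf, Language.mem_inf, hT0, hT1, memL_preimage, memL_preimage,
      hdrop]
    simp
  · rw [hR, memL_sup, Language.mem_inf, Language.mem_inf, hT0, hT1, memL_preimage, memL_preimage,
      hdrop]
    simp

/-- **The count of the sum relation**: `#_R^{m+1}(x) = #_{L₀}^m(x) + #_{L₁}^m(x)` (split on the
first coin, `cnt_succ`). [cite: FennerFortnowKurtz1994, Proposition 3.5 (proof)] -/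
theorem countWitnesses_sumRel {R L₀ L₁ : Language Bool}
    (hR0 : ∀ x y : List Bool, boolPair x (false :: y) ∈ R ↔ boolPair x y ∈ L₀)
    (hR1 : ∀ x y : List Bool, boolPair x (true :: y) ∈ R ↔ boolPair x y ∈ L₁) (m : ℕ)
    (x : List Bool) :
    countWitnesses R (m + 1) x = countWitnesses L₀ m x + countWitnesses L₁ m x := by
  rw [countWitnesses_eq_cnt, countWitnesses_eq_cnt, countWitnesses_eq_cnt, cnt_succ]
  congr 1
  · exact cnt_congr fun y _ => by simp only [Set.mem_setOf_eq]; exact hR0 x y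
  · exact cnt_congr fun y _ => by simp only [Set.mem_setOf_eq]; exact hR1 x y

/-! ### The two directions -/

/-- **(→) of Proposition 4.2(1)**: for `L ∈ PP` the gap `g(x) = #acc(x) − #rej(x)` of the majority
machine (witness language `L' ∈ P`, `p(|x|)` coins; `#rej` is the `#P` function of `L'ᶜ ∈ P`) is in
`GapP = #P − #P` and `x ∈ L ↔ g(x) > 0`. [cite: FennerFortnowKurtz1994, Proposition 4.2(1)] -/
theorem gapP_of_mem_PP {L : Language Bool} (hL : L ∈ PP) :
    ∃ g ∈ GapP, ∀ x : List Bool, x ∈ L ↔ 0 < g x := by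
  obtain ⟨L', hL', p, hp⟩ := hL
  refine ⟨fun x => (countWitnesses L' (p.eval x.length) x : ℤ) -
      (countWitnesses L'ᶜ (p.eval x.length) x : ℤ),
    ⟨fun x => countWitnesses L' (p.eval x.length) x, ⟨L', hL', p, fun x => rfl⟩,
      fun x => countWitnesses L'ᶜ (p.eval x.length) x,
      ⟨L'ᶜ, (compl_mem_P_iff (L := L')).2 hL', p, fun x => rfl⟩, fun x => rfl⟩,
    fun x => ?_⟩
  have h := countWitnesses_add_compl L' (p.eval x.length) x
  rw [hp x, half_lt_uniformProb_iff, ← countWitnesses_eq_cnt, ← h]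
  simp only
  omega

/-- **(←) of Proposition 4.2(1)**: if `x ∈ L ↔ f₁(x) − f₂(x) > 0` with `f₁, f₂ ∈ #P`, then `L ∈ PP`:
after padding both witness relations to the common length `B = (p₁ + p₂)(|x|)`, the majority
machine with `B + 1` coins `b·y` accepts `0y` iff `⟨x,y⟩ ∈ R₁` and `1y` iff `⟨x,y⟩ ∉ R₂`
(`exists_sumRel`), accepting `f₁(x) + 2^B − f₂(x)` strings — a strict majority iff `f₁(x) > f₂(x)`
(the machine `M'` of Proposition 3.5, threshold `2^B` as in the proof of Proposition 4.2 via
Lemma 4.3). [cite: FennerFortnowKurtz1994, Proposition 4.2(1) (proof, p. 128)] -/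
theorem mem_PP_of_gapP {L : Language Bool} {g : List Bool → ℤ} (hg : g ∈ GapP)
    (hL : ∀ x : List Bool, x ∈ L ↔ 0 < g x) : L ∈ PP := by
  obtain ⟨f₁, ⟨R₁, hR₁, p₁, hf₁⟩, f₂, ⟨R₂, hR₂, p₂, hf₂⟩, hgx⟩ := hg
  -- pad both relations to the common witness length `B = (p₁ + p₂)(|x|)`
  obtain ⟨R₁p, hR₁p, hspec₁⟩ := exists_padRel p₁ hR₁
  obtain ⟨R₂p, hR₂p, hspec₂⟩ := exists_padRel p₂ hR₂
  have hc₁ : ∀ x : List Bool, countWitnesses R₁p ((p₁ + p₂).eval x.length) x = f₁ x := fun x => by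
    rw [hf₁, countWitnesses_of_padSpec R₁ R₁p x (p₁.eval x.length) (hspec₁ x) (by simp [eval_add])]
  have hc₂ : ∀ x : List Bool,
      countWitnesses R₂pᶜ ((p₁ + p₂).eval x.length) x + f₂ x = 2 ^ (p₁ + p₂).eval x.length :=
    fun x => by
    rw [hf₂, ← countWitnesses_of_padSpec R₂ R₂p x (p₂.eval x.length) (hspec₂ x)
      (show p₂.eval x.length ≤ (p₁ + p₂).eval x.length by simp [eval_add]), add_comm]
    exact countWitnesses_add_compl R₂p _ x
  -- the majority relation: `0y ↦ [⟨x,y⟩ ∈ R₁p]`, `1y ↦ [⟨x,y⟩ ∉ R₂p]`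
  obtain ⟨R, hR, hR0, hR1⟩ := exists_sumRel hR₁p ((compl_mem_P_iff (L := R₂p)).2 hR₂p)
  refine ⟨R, hR, p₁ + p₂ + 1, fun x => ?_⟩
  rw [hL x, hgx x, half_lt_uniformProb_iff, ← countWitnesses_eq_cnt, eval_add, eval_one,
    countWitnesses_sumRel hR0 hR1, hc₁, pow_succ, ← hc₂ x]
  omega

end PPGapP

open PPGapP

/-- **`PP` via `GapP`** — discharge of the named fact `mem_PP_iff_gapP` (`Counting.lean`):
`L ∈ PP ↔ ∃ g ∈ GapP, ∀ x, (x ∈ L ↔ 0 < g x)`. Fenner–Fortnow–Kurtz, Proposition 4.2(1):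
"`L ∈ PP ⟺ (∃M)(∀x)[x ∈ L ⟺ gap_M(x) > 0]`", where `GapP = {gap_M | M a CM} = #P − #P`
(Def. 3.2, Proposition 3.5); the tree's `PP = pMajority P` is Gill's strict-majority class and the
tree's `GapP` is `#P − #P`. (→) `gapP_of_mem_PP`, (←) `mem_PP_of_gapP`.
[cite: FennerFortnowKurtz1994, Proposition 4.2(1)] -/
theorem mem_PP_iff_gapP_holds : mem_PP_iff_gapP := by
  intro L
  exact ⟨gapP_of_mem_PP, fun ⟨g, hg, hgL⟩ => mem_PP_of_gapP hg hgL⟩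

end Literature.Computability.Complexity

end
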